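import Summits.SmoothPoincare4.SmoothPoincare4.Theses.EntropyRung
import Literature.Geometry.Lorentzian.Basic
import Literature.Geometry.Lorentzian.VolumeChartIntegral

/-!
# Transplant comparison, II: the product measure `dV_h ⊗ dt` in a chart of `N`

Helper file of the stub `stub_transplantComparison` (U3) of line `collapsed-ends-usc`, crux
`EntropyRung.NoncompactShrinkerGap` (stmt-SmoothPoincare4-10868): the fact-free change of variables
under a `(1 ± η)`-transplant `N × ℝ → M` (see
`EntropyRungNoncompactShrinkerGapStubTransplantComparison.lean` for the statement and the plan).

This file: measurability of `s ∩ f⁻¹ B` for `f` continuous on a measurable `s`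
(`measurableSet_inter_preimage_of_continuousOn`), and the product measure of the Riemannian
measure of `N³` with Lebesgue measure on `ℝ` read in a chart `φ` of `N`:
`∫ G d(V_h ⊗ dt) = ∫_{φ.target × ℝ} G(φ⁻¹ z, t) √det h_{ij}(z) dz dt`
(`lintegral_prod_eq_lintegral_chart`, Tonelli and the tree's chart formula
`lintegral_eq_lintegral_chart` of `VolumeChartIntegral.lean`) and its set form
`prod_apply_eq_lintegral_chart`.

## References

* H. Federer, *Geometric Measure Theory*, Springer 1969, §3.2.3 (area formula), §3.2.46
  (Hausdorff measure of a Riemannian manifold). [Federer1969]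
* I. Chavel, *Riemannian Geometry: A Modern Introduction*, 2nd ed., CUP 2006, §III.3, (III.3.6)
  (integration in local coordinates). [Chavel2006]
-/

noncomputable section

-- the prescribed namespace `Summit.<Summit>.<Problem>.…` repeats `SmoothPoincare4` (summit = problem)
set_option linter.dupNamespace false

namespace Summit.SmoothPoincare4.SmoothPoincare4.Theorems.NoncompactShrinkerGapTransplantComparison

open scoped Manifold ContDiff ENNReal NNReal Topology Bundle
open MeasureTheory Set
open Literature.Geometry.Lorentzian Literature.Geometry.Riemannian


/-! ### Measurability of preimages under maps continuous on a measurable set -/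

section Measurable

/-- If `f` is continuous on the measurable set `s`, then `s ∩ f ⁻¹' B` is measurable for every
measurable `B` (piecewise extension by a constant is measurable). [folklore] -/
theorem measurableSet_inter_preimage_of_continuousOn {α β : Type*} [TopologicalSpace α]
    [MeasurableSpace α] [OpensMeasurableSpace α] [TopologicalSpace β] [MeasurableSpace β]
    [BorelSpace β] {f : α → β} {s : Set α} (hf : ContinuousOn f s) (hs : MeasurableSet s)
    {B : Set β} (hB : MeasurableSet B) : MeasurableSet (s ∩ f ⁻¹' B) := by
  classical
  rcases s.eq_empty_or_nonempty with rfl | ⟨a, -⟩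
  · simp
  have hm : Measurable (s.piecewise f (fun _ ↦ f a)) :=
    hf.measurable_piecewise continuousOn_const hs
  have : s ∩ f ⁻¹' B = s ∩ (s.piecewise f (fun _ ↦ f a)) ⁻¹' B := by
    ext x
    simp only [mem_inter_iff, mem_preimage]
    constructor
    · rintro ⟨hx, hxB⟩; exact ⟨hx, by rwa [piecewise_eq_of_mem _ _ _ hx]⟩
    · rintro ⟨hx, hxB⟩; exact ⟨hx, by rwa [piecewise_eq_of_mem _ _ _ hx] at hxB⟩
  rw [this]
  exact hs.inter (hm hB)

end Measurable

/-! ### The product measure `dV_h ⊗ dt` in a chart of `N` -/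

section Source

variable {N : Type*} [TopologicalSpace N] [ChartedSpace E3 N] [IsManifold (𝓡 3) 1 N] [T3Space N]
  [MeasurableSpace N] [BorelSpace N] {n : ℕ∞ω}
  (h' : Bundle.ContMDiffRiemannianMetric (𝓡 3) n E3 (TangentSpace (𝓡 3) : N → Type _))

omit [IsManifold (𝓡 3) 1 N] [T3Space N] [MeasurableSpace N] [BorelSpace N] in
/-- The inverse chart times the identity, `(z, t) ↦ (φ⁻¹ z, t)`, is continuous on
`φ.target × ℝ`. [folklore] -/
theorem continuousOn_chartSymm_prod (x : N) :
    ContinuousOn (fun q : E3 × ℝ ↦ ((extChartAt (𝓡 3) x).symm q.1, q.2))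
      ((extChartAt (𝓡 3) x).target ×ˢ (univ : Set ℝ)) :=
  ((continuousOn_extChartAt_symm x).comp continuousOn_fst fun _ hq ↦ hq.1).prodMk continuousOn_snd

/-- **The product measure `dV_h ⊗ dt` in a chart of `N`, integral form**: for `G ≥ 0` measurable
on `N × ℝ` vanishing off `φ.source × ℝ` (`φ` the extended chart at `x`),
`∫ G d(V_h ⊗ dt) = ∫_{φ.target × ℝ} G(φ⁻¹ z, t) √(det h_{ij}(z)) dz dt` (Tonelli and the chart
formula `lintegral_eq_lintegral_chart` for `dV_h`). [cite: Chavel2006, §III.3 (III.3.6)] -/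
theorem lintegral_prod_eq_lintegral_chart (x : N) {G : N × ℝ → ℝ≥0∞} (hG : Measurable G)
    (hsupp : Function.support G ⊆ (extChartAt (𝓡 3) x).source ×ˢ (univ : Set ℝ)) :
    ∫⁻ p, G p ∂((riemannianMeasure h').prod volume) =
      ∫⁻ q in (extChartAt (𝓡 3) x).target ×ˢ (univ : Set ℝ),
        G ((extChartAt (𝓡 3) x).symm q.1, q.2) *
          ENNReal.ofReal (Real.sqrt (chartGramMatrix h' x q.1).det) := by
  set φ := extChartAt (𝓡 3) x with hφ
  rw [lintegral_prod _ hG.aemeasurable]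
  have hin : Measurable fun y ↦ ∫⁻ t, G (y, t) := hG.lintegral_prod_right'
  have hsupp' : Function.support (fun y ↦ ∫⁻ t, G (y, t)) ⊆ φ.source := by
    intro y hy
    by_contra hys
    apply hy
    have h0 : ∀ t, G (y, t) = 0 := fun t ↦ by
      by_contra hne
      exact hys (hsupp (Function.mem_support.2 hne)).1
    simp [h0]
  rw [lintegral_eq_lintegral_chart h' x hin hsupp']
  have hmt : MeasurableSet φ.target := measurableSet_extChartAt_target (I := 𝓡 3) x
  have hT : MeasurableSet (φ.target ×ˢ (univ : Set ℝ)) := hmt.prod MeasurableSet.univ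
  have heN := continuousOn_chartSymm_prod x
  have hF : AEMeasurable (fun q : E3 × ℝ ↦ G (φ.symm q.1, q.2) *
      ENNReal.ofReal (Real.sqrt (chartGramMatrix h' x q.1).det))
      ((volume : Measure (E3 × ℝ)).restrict (φ.target ×ˢ univ)) := by
    refine (hG.comp_aemeasurable (heN.aemeasurable hT)).mul ?_
    exact ENNReal.measurable_ofReal.comp_aemeasurable
      (((continuousOn_sqrt_det_chartGramMatrix h' x).comp continuousOn_fst
        (fun q hq ↦ hq.1)).aemeasurable hT)
  have hrestr : (volume : Measure (E3 × ℝ)).restrict (φ.target ×ˢ univ) =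
      (volume.restrict φ.target).prod ((volume : Measure ℝ).restrict univ) := by
    rw [Measure.prod_restrict]; rfl
  rw [hrestr] at hF ⊢
  rw [lintegral_prod _ hF]
  refine setLIntegral_congr_fun hmt (fun z _ ↦ ?_)
  have hmz : Measurable fun t ↦ G (φ.symm z, t) := hG.comp measurable_prodMk_left
  rw [Measure.restrict_univ]
  change _ = ∫⁻ t, G (φ.symm z, t) * ENNReal.ofReal (Real.sqrt (chartGramMatrix h' x z).det)
  rw [lintegral_mul_const _ hmz]

/-- **The product measure `dV_h ⊗ dt` in a chart of `N`, set form**: for measurable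
`S ⊆ φ.source × ℝ`, `(V_h ⊗ dt)(S) = ∫_{S'} √(det h_{ij}(z)) dz dt` where
`S' = (φ.target × ℝ) ∩ (φ⁻¹ × id)⁻¹ S` is the chart image of `S`. [cite: Chavel2006, §III.3 (III.3.6)] -/
theorem prod_apply_eq_lintegral_chart (x : N) {S : Set (N × ℝ)} (hS : MeasurableSet S)
    (hSx : S ⊆ (extChartAt (𝓡 3) x).source ×ˢ (univ : Set ℝ)) :
    ((riemannianMeasure h').prod volume) S =
      ∫⁻ q in ((extChartAt (𝓡 3) x).target ×ˢ (univ : Set ℝ)) ∩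
          (fun q : E3 × ℝ ↦ ((extChartAt (𝓡 3) x).symm q.1, q.2)) ⁻¹' S,
        ENNReal.ofReal (Real.sqrt (chartGramMatrix h' x q.1).det) := by
  set φ := extChartAt (𝓡 3) x with hφ
  set eN : E3 × ℝ → N × ℝ := fun q ↦ (φ.symm q.1, q.2) with heN_def
  have hmt : MeasurableSet φ.target := measurableSet_extChartAt_target (I := 𝓡 3) x
  have hT : MeasurableSet (φ.target ×ˢ (univ : Set ℝ)) := hmt.prod MeasurableSet.univ
  have hS' : MeasurableSet ((φ.target ×ˢ (univ : Set ℝ)) ∩ eN ⁻¹' S) :=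
    measurableSet_inter_preimage_of_continuousOn (continuousOn_chartSymm_prod x) hT hS
  have h1 := lintegral_prod_eq_lintegral_chart h' x (measurable_one.indicator hS)
    (support_indicator_subset.trans hSx)
  rw [lintegral_indicator_one hS] at h1
  rw [h1]
  have h2 : ∀ q ∈ φ.target ×ˢ (univ : Set ℝ),
      S.indicator (1 : N × ℝ → ℝ≥0∞) (eN q) *
        ENNReal.ofReal (Real.sqrt (chartGramMatrix h' x q.1).det) =
      ((φ.target ×ˢ (univ : Set ℝ)) ∩ eN ⁻¹' S).indicator
        (fun q ↦ ENNReal.ofReal (Real.sqrt (chartGramMatrix h' x q.1).det)) q := by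
    intro q hq
    by_cases hqS : eN q ∈ S
    · rw [indicator_of_mem hqS, indicator_of_mem (mem_inter hq hqS), Pi.one_apply, one_mul]
    · rw [indicator_of_notMem hqS, indicator_of_notMem (fun h ↦ hqS h.2), zero_mul]
  rw [setLIntegral_congr_fun hT h2, lintegral_indicator hS', Measure.restrict_restrict hS',
    inter_eq_left.2 inter_subset_left]

end Source

/-! ### The registered sub-goal of this file -/

/-- **Registered sub-goal `stub_transplantSourceChart`** (the product measure `dV_h ⊗ dt` in a
chart of `N`, set form — the statement of `prod_apply_eq_lintegral_chart` with all binders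
explicit): `(V_h ⊗ dt)(S) = ∫_{S'} √det h_{ij}(z) dz dt` over the chart image `S'`.
[cite: Chavel2006, §III.3 (III.3.6)] -/
theorem stub_transplantSourceChart : ∀ (N : Type) [TopologicalSpace N] [ChartedSpace E3 N] [IsManifold (𝓡 3) 1 N] [T3Space N] [MeasurableSpace N] [BorelSpace N] (n : ℕ∞ω) (h' : Bundle.ContMDiffRiemannianMetric (𝓡 3) n E3 (TangentSpace (𝓡 3) : N → Type _)) (x : N) (S : Set (N × ℝ)), MeasurableSet S → S ⊆ (extChartAt (𝓡 3) x).source ×ˢ (Set.univ : Set ℝ) → ((riemannianMeasure h').prod volume) S = ∫⁻ q in ((extChartAt (𝓡 3) x).target ×ˢ (Set.univ : Set ℝ)) ∩ (fun q : E3 × ℝ ↦ ((extChartAt (𝓡 3) x).symm q.1, q.2)) ⁻¹' S, ENNReal.ofReal (Real.sqrt (chartGramMatrix h' x q.1).det) := by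
  intro N _ _ _ _ _ _ n h' x S hS hSx
  exact prod_apply_eq_lintegral_chart h' x hS hSx

end Summit.SmoothPoincare4.SmoothPoincare4.Theorems.NoncompactShrinkerGapTransplantComparison
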